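import Summits.KontsevichZagierPeriods.KontsevichZagierPeriods.Theorems.RootDecompWalshStrataQuadricWalls03

/-!
# The `z`-glue with affine walls, part 4/4: the prism split and the single residual

Declarations `wI` … `quadricBakerDescent_of_sqrtDescentW` of the farm-checked gen-7 file: the prism cell of the
shear move is the wall cell `1 − 2x < z < 1` over `{x < 1/2}` plus the wall cell `0 < z < 2 − 2x` over `{x > 1/2}`
plus the null plane `{x = 1/2}` (`Quadric₃.inBaker_prismCell`); the adapted atoms of the cube glue are wall-family
atoms with walls `0, 1` (`atom_eq_wfam_atom`, `sqrtDescent₂_of_wall`); hence the route item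
`Theses.RootDecompWalshStrata.QuadricBakerDescent` (stmt-KontsevichZagierPeriods-27597) follows from the SINGLE
residual kind `hW : ∀ L ℓ₁ ℓ₂ g γ σ, [atomFam (L.wfam ℓ₁ ℓ₂ g) σ, γ√D_L] ∈ InBaker` (square-root descent of the fibre
discriminant on wall-family atoms; CONDITIONAL, credits nothing until `hW` lands).  See the module docstring of
`RootDecompWalshStrataQuadricWalls01` (part 1). [KontsevichZagier2001 §1.2 rules (1)–(3); BCR1998 §2; this node gen 5–7]
-/

noncomputable section

open Literature.NumberTheory.Transcendental
open MeasureTheory Set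
open MvPolynomial (aeval X C)
open Literature.ModelTheory.ExponentialFields (IsSemialgebraic isSemialgebraic_univ
  isSemialgebraic_setOf_eval_pos isSemialgebraic_setOf_eval_lt isSemialgebraic_setOf_eval_le
  isSemialgebraic_setOf_eval_nonneg isSemialgebraic_setOf_eval_eq_zero
  isSemialgebraic_setOf_eval_ne_zero continuous_aeval_real tarski_seidenberg_real_holds)
open Summit.KontsevichZagierPeriods.RootDecompWalshStrata.WalshSpanProof (isSemialgebraic_cubeSet
  isBounded_cubeSet)
open Summit.KontsevichZagierPeriods.RootDecompWalshStrata.ConeSpecimen (unitIoo isSemialgebraic_unitIoo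
  unitIoo_subset_Icc mem_unitIoo)
open Summit.KontsevichZagierPeriods.RootDecompWalshStrata.PointlessOctant (boxTwo isSemialgebraic_boxTwo
  boxTwo_subset_Icc)

namespace Summit.KontsevichZagierPeriods.RootDecompWalshStrata.ConicDescent.BallCube

/-! #### 31.6 The prism cell is two wall cells and a null plane -/

/-- The wall `1 − 2x`. -/
def wI : Wall := ⟨1, -2, 0⟩
/-- The wall `1`. -/
def wOne : Wall := ⟨1, 0, 0⟩
/-- The base constraint `1/2 − x`. -/
def gI : Wall := ⟨1 / 2, -1, 0⟩
/-- The wall `0`. -/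
def wZero : Wall := ⟨0, 0, 0⟩
/-- The wall `2 − 2x`. -/
def wII : Wall := ⟨2, -2, 0⟩
/-- The base constraint `x − 1/2`. -/
def gII : Wall := ⟨-1 / 2, 1, 0⟩

/-- `wI(x, y) = 1 − 2x`. [this node] -/
@[simp] theorem wI_eval (x y : ℝ) : wI.eval x y = 1 - 2 * x := by
  simp only [wI, Wall.eval]; push_cast; ring

/-- `wOne(x, y) = 1`. [this node] -/
@[simp] theorem wOne_eval (x y : ℝ) : wOne.eval x y = 1 := by
  simp only [wOne, Wall.eval]; push_cast; ring

/-- `gI(x, y) = 1/2 − x`. [this node] -/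
@[simp] theorem gI_eval (x y : ℝ) : gI.eval x y = 1 / 2 - x := by
  simp only [gI, Wall.eval]; push_cast; ring

/-- `wZero(x, y) = 0`. [this node] -/
@[simp] theorem wZero_eval (x y : ℝ) : wZero.eval x y = 0 := by
  simp only [wZero, Wall.eval]; push_cast; ring

/-- `wII(x, y) = 2 − 2x`. [this node] -/
@[simp] theorem wII_eval (x y : ℝ) : wII.eval x y = 2 - 2 * x := by
  simp only [wII, Wall.eval]; push_cast; ring

/-- `gII(x, y) = x − 1/2`. [this node] -/
@[simp] theorem gII_eval (x y : ℝ) : gII.eval x y = x - 1 / 2 := by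
  simp only [gII, Wall.eval]; push_cast; ring

namespace Quadric₃

variable (K : Quadric₃)

/-- The half `x < 1/2` of the prism cell is the wall cell `1 − 2x < z < 1` over `{x < 1/2}`.
[this node] -/
theorem mem_wallCell_I_iff (w : Fin 3 → ℝ) :
    w ∈ K.wallCell wI wOne gI ↔ w ∈ K.prismCell ∧ w 0 < 1 / 2 := by
  simp only [wallCell, wallBox, prismCell, Quadric₃.cell, mem_setOf_eq, wI_eval, wOne_eval, gI_eval]
  constructor
  · rintro ⟨⟨hc, hg, hl1, hl2⟩, hp⟩
    exact ⟨⟨⟨hc, hp⟩, by linarith, by linarith [(hc 2).2]⟩, by linarith⟩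
  · rintro ⟨⟨⟨hc, hp⟩, h1, h2⟩, hx⟩
    exact ⟨⟨hc, by linarith, by linarith, (hc 2).2⟩, hp⟩

/-- The half `x > 1/2` of the prism cell is the wall cell `0 < z < 2 − 2x` over `{x > 1/2}`.
[this node] -/
theorem mem_wallCell_II_iff (w : Fin 3 → ℝ) :
    w ∈ K.wallCell wZero wII gII ↔ w ∈ K.prismCell ∧ 1 / 2 < w 0 := by
  simp only [wallCell, wallBox, prismCell, Quadric₃.cell, mem_setOf_eq, wZero_eval, wII_eval,
    gII_eval]
  constructor
  · rintro ⟨⟨hc, hg, hl1, hl2⟩, hp⟩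
    exact ⟨⟨⟨hc, hp⟩, by linarith, by linarith⟩, by linarith⟩
  · rintro ⟨⟨⟨hc, hp⟩, h1, h2⟩, hx⟩
    exact ⟨⟨hc, by linarith, (hc 2).1, by linarith⟩, hp⟩

/-- **The prism cell for `A ≠ 0`.** `[prismCell, q]` lands in the Baker sector modulo relations,
given `[atom, γ√D] ∈ InBaker` on the wall-family atoms of every normal form: the prism is the wall
cell over `{x < 1/2}` plus the wall cell over `{x > 1/2}` plus the null plane `{x = 1/2}` (rule 1a).
[KontsevichZagier2001 §1.2; this node] -/
theorem inBaker_prismCell (hA : K.A ≠ 0)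
    (hW : ∀ (M : Quadric₃) (ℓ₁ ℓ₂ g : Wall) (γ : ℚ) (σ : Fin 6 → SignType) (r : KZ.IntegralRep 2),
      r.domain = atomFam (M.wfam ℓ₁ ℓ₂ g) σ →
      EqOn r.integrand (fun v => (γ : ℝ) * √(M.Dxy (v 0) (v 1))) r.domain → InBaker (KZ.of r))
    (q : ℚ) (ρ : KZ.IntegralRep 3) (hdom : ρ.domain = K.prismCell)
    (hint : ∀ w ∈ ρ.domain, ρ.integrand w = q) : InBaker (KZ.of ρ) := by
  classical
  set B₂ : Set (Fin 3 → ℝ) := {w | w ∈ K.prismCell ∧ w 0 = 1 / 2} with hB₂def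
  have hA₁ : IsSemialgebraic ℚ (K.wallCell wI wOne gI) := K.isSemialgebraic_wallCell _ _ _
  have hB₁ : IsSemialgebraic ℚ (K.wallCell wZero wII gII) := K.isSemialgebraic_wallCell _ _ _
  have hB₂ : IsSemialgebraic ℚ B₂ := by
    convert K.isSemialgebraic_prismCell.inter
      (isSemialgebraic_setOf_eval_eq_zero (R := ℝ) (X 0 - C (1 / 2) : MvPolynomial (Fin 3) ℚ)) using 1
    ext w
    simp only [hB₂def, mem_setOf_eq, mem_inter_iff, map_sub, MvPolynomial.aeval_X,
      MvPolynomial.aeval_C, eq_ratCast, sub_eq_zero]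
    push_cast
    rfl
  have hcov : ρ.domain = K.wallCell wI wOne gI ∪ (K.wallCell wZero wII gII ∪ B₂) := by
    rw [hdom]
    ext w
    simp only [mem_union, mem_wallCell_I_iff, mem_wallCell_II_iff, hB₂def, mem_setOf_eq]
    constructor
    · intro hw
      rcases lt_trichotomy (w 0) (1 / 2) with h | h | h
      · exact Or.inl ⟨hw, h⟩
      · exact Or.inr (Or.inr ⟨hw, h⟩)
      · exact Or.inr (Or.inl ⟨hw, h⟩)
    · rintro (⟨hw, _⟩ | ⟨hw, _⟩ | ⟨hw, _⟩) <;> exact hw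
  have hwallI : ∀ v ∈ Wbase gI, 0 ≤ wI.eval (v 0) (v 1) ∧
      wI.eval (v 0) (v 1) ≤ wOne.eval (v 0) (v 1) ∧ wOne.eval (v 0) (v 1) ≤ 1 := fun v hv => by
    have h0 := (hv.1 0).1
    have hg : 0 < gI.eval (v 0) (v 1) := hv.2
    simp only [wI_eval, wOne_eval, gI_eval] at hg ⊢
    exact ⟨by linarith, by linarith, le_rfl⟩
  have hwallII : ∀ v ∈ Wbase gII, 0 ≤ wZero.eval (v 0) (v 1) ∧
      wZero.eval (v 0) (v 1) ≤ wII.eval (v 0) (v 1) ∧ wII.eval (v 0) (v 1) ≤ 1 := fun v hv => by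
    have h1 := (hv.1 0).2
    have hg : 0 < gII.eval (v 0) (v 1) := hv.2
    simp only [wZero_eval, wII_eval, gII_eval] at hg ⊢
    exact ⟨le_rfl, by linarith, by linarith⟩
  have h1r : K.wallCell wI wOne gI ⊆ ρ.domain := fun w hw => hcov ▸ Or.inl hw
  have h23r : K.wallCell wZero wII gII ∪ B₂ ⊆ ρ.domain := fun w hw => hcov ▸ Or.inr hw
  refine InBaker.of_split ρ hA₁ (hB₁.union hB₂) h1r h23r hcov ?_ ?_ ?_
  · have : K.wallCell wI wOne gI ∩ (K.wallCell wZero wII gII ∪ B₂) = ∅ := by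
      ext w
      simp only [mem_inter_iff, mem_union, mem_wallCell_I_iff, mem_wallCell_II_iff, hB₂def,
        mem_setOf_eq, mem_empty_iff_false, iff_false, not_and]
      rintro ⟨-, h⟩ (⟨-, h'⟩ | ⟨-, h'⟩) <;> linarith
    rw [this, measure_empty]
  · exact K.inBaker_wallCell hA wI wOne gI hwallI q (fun M => hW M wI wOne gI) _ rfl
      fun w hw => hint w (h1r hw)
  · refine InBaker.of_split _ hB₁ hB₂ (fun w hw => Or.inl hw) (fun w hw => Or.inr hw) rfl ?_ ?_ ?_
    · have : K.wallCell wZero wII gII ∩ B₂ = ∅ := by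
        ext w
        simp only [mem_inter_iff, mem_wallCell_II_iff, hB₂def, mem_setOf_eq, mem_empty_iff_false,
          iff_false, not_and]
        rintro ⟨-, h⟩ ⟨-, h'⟩
        linarith
      rw [this, measure_empty]
    · exact K.inBaker_wallCell hA wZero wII gII hwallII q (fun M => hW M wZero wII gII) _ rfl
        fun w hw => hint w (h23r (Or.inl hw))
    · refine InBaker.of_subset_zeroSet _ (X 0 - C (1 / 2) : MvPolynomial (Fin 3) ℚ)
        ⟨fun _ => 0, by simp⟩ fun w hw => ?_
      have hw' : w 0 = 1 / 2 := (show w ∈ B₂ from hw).2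
      simp only [map_sub, MvPolynomial.aeval_X, MvPolynomial.aeval_C, eq_ratCast, hw']
      push_cast; ring

/-! #### 31.7 The adapted atoms are wall-family atoms; the single residual -/

/-- `p(x, y, 0) = C₀`. [this node] -/
theorem pxyz_zero (x y : ℝ) : K.pxyz x y 0 = K.Cxy x y := by
  simp only [pxyz]; ring

/-- `p(x, y, 1) = C₁`. [this node] -/
theorem pxyz_one (x y : ℝ) : K.pxyz x y 1 = K.C1xy x y := by
  simp only [pxyz, C1xy]; ring

/-- **The adapted atoms are atoms of the wall family with walls `0, 1` over the whole square**
(`D, C₀, B, C₁, 2A + B, 1` versus `D, C₀, C₁, B, 2A + B`). [this node] -/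
theorem atom_eq_wfam_atom (σ : Fin 5 → SignType) :
    K.atom σ = atomFam (K.wfam wZero wOne wOne) ![σ 0, σ 1, σ 3, σ 2, σ 4, 1] := by
  ext v
  constructor
  · intro hv
    obtain ⟨s0, s1, s2, s3, s4⟩ := K.atom_sign σ hv
    refine ⟨hv.1, fun i => ?_⟩
    match i with
    | 0 =>
      show SignType.sign ((K.conic 0).pxy (v 0) (v 1)) = σ 0
      rw [← K.adapted_eq_conic]; exact s0
    | 1 =>
      show SignType.sign (((K.shiftW wZero).conic 1).pxy (v 0) (v 1)) = σ 1
      rw [← (K.shiftW wZero).adapted_eq_conic]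
      show SignType.sign ((K.shiftW wZero).Cxy (v 0) (v 1)) = σ 1
      rw [shiftW_Cxy, wZero_eval, pxyz_zero]; exact s1
    | 2 =>
      show SignType.sign (((K.shiftW wZero).conic 3).pxy (v 0) (v 1)) = σ 3
      rw [← (K.shiftW wZero).adapted_eq_conic]
      show SignType.sign ((K.shiftW wZero).Bxy (v 0) (v 1)) = σ 3
      rw [shiftW_Bxy, wZero_eval, mul_zero, zero_add]; exact s3
    | 3 =>
      show SignType.sign (((K.shiftW wOne).conic 1).pxy (v 0) (v 1)) = σ 2
      rw [← (K.shiftW wOne).adapted_eq_conic]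
      show SignType.sign ((K.shiftW wOne).Cxy (v 0) (v 1)) = σ 2
      rw [shiftW_Cxy, wOne_eval, pxyz_one]; exact s2
    | 4 =>
      show SignType.sign (((K.shiftW wOne).conic 3).pxy (v 0) (v 1)) = σ 4
      rw [← (K.shiftW wOne).adapted_eq_conic]
      show SignType.sign ((K.shiftW wOne).Bxy (v 0) (v 1)) = σ 4
      rw [shiftW_Bxy, wOne_eval, mul_one]; exact s4
    | 5 =>
      show SignType.sign (wOne.toConic.pxy (v 0) (v 1)) = 1
      rw [Wall.toConic_pxy, wOne_eval]; exact sign_one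
  · intro hv
    obtain ⟨s0, s1, s2, s3, s4, -⟩ := K.wfam_sign wZero wOne wOne _ hv
    rw [shiftW_Cxy, wZero_eval, pxyz_zero] at s1
    rw [shiftW_Bxy, wZero_eval, mul_zero, zero_add] at s2
    rw [shiftW_Cxy, wOne_eval, pxyz_one] at s3
    rw [shiftW_Bxy, wOne_eval, mul_one] at s4
    refine ⟨hv.1, fun i => ?_⟩
    match i with
    | 0 => exact s0
    | 1 => exact s1
    | 2 => exact s3
    | 3 => exact s2
    | 4 => exact s4

/-- **`SqrtDescent₂` on adapted atoms is a sub-case of the wall-family residual.** [this node] -/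
theorem sqrtDescent₂_of_wall
    (hW : ∀ (M : Quadric₃) (ℓ₁ ℓ₂ g : Wall) (γ : ℚ) (σ : Fin 6 → SignType) (r : KZ.IntegralRep 2),
      r.domain = atomFam (M.wfam ℓ₁ ℓ₂ g) σ →
      EqOn r.integrand (fun v => (γ : ℝ) * √(M.Dxy (v 0) (v 1))) r.domain → InBaker (KZ.of r))
    (γ : ℚ) (σ : Fin 5 → SignType) (r : KZ.IntegralRep 2) (hrd : r.domain = K.atom σ)
    (hri : EqOn r.integrand (fun v => (γ : ℝ) * √(K.Dxy (v 0) (v 1))) r.domain) :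
    InBaker (KZ.of r) :=
  hW K wZero wOne wOne γ _ r (hrd.trans (K.atom_eq_wfam_atom σ)) hri

end Quadric₃

/-- **The quadric stratum `d ≤ 3` of the route item modulo ONE residual kind** — square-root descent
of the fibre discriminant on the atoms of the WALL FAMILIES `(D, p∘ℓ₁, 2Aℓ₁ + B, p∘ℓ₂, 2Aℓ₂ + B, g)`:
`hW : ∀ L ℓ₁ ℓ₂ g γ σ, [atomFam (L.wfam ℓ₁ ℓ₂ g) σ, γ·√D_L] ∈ InBaker`.  Given `hW`, the item
`QuadricBakerDescent` (stmt-KontsevichZagierPeriods-27597) holds: `d ≤ 2` is the landed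
`quadricBakerDescent_two`; for `d = 3`, a normal form with `A ≠ 0` is the cube glue `inBaker_cell3`
(`hS = sqrtDescent₂_of_wall`), `c₂₂ ≠ 0` / `c₁₁ ≠ 0` are swaps, a constant fibre coefficient is
`affineDescent₂`/`quadDescent₂`, and a genuinely multi-affine cell is SHEARED (rule 2, det `1/2`) into a
prism cell with a square term, which is two wall cells and a null plane (`inBaker_prismCell`).  On each
conic `{p∘ℓ = 0}` of a wall family the discriminant restricts to the square `(2Aℓ + B)²` — the
genus-0 structure behind the expected proof of `hW` (NODE.md gen 6–8: Euler chart through the rational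
tangency points). [KontsevichZagier2001 §1.2 rules (1)–(3); BCR1998 §2; this node gen 5–7] -/
theorem quadricBakerDescent_of_sqrtDescentW
    (hW : ∀ (L : Quadric₃) (ℓ₁ ℓ₂ g : Wall) (γ : ℚ) (σ : Fin 6 → SignType) (r : KZ.IntegralRep 2),
      r.domain = atomFam (L.wfam ℓ₁ ℓ₂ g) σ →
      EqOn r.integrand (fun v => (γ : ℝ) * √(L.Dxy (v 0) (v 1))) r.domain → InBaker (KZ.of r)) :
    Summit.KontsevichZagierPeriods.KontsevichZagierPeriods.Theses.RootDecompWalshStrata.QuadricBakerDescent :=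
  quadricBakerDescent_of_sqrtDescent₂_of_prism (fun K => K.sqrtDescent₂_of_wall hW)
    fun L hA q ρ hd hi => L.inBaker_prismCell hA hW q ρ hd hi

end Summit.KontsevichZagierPeriods.RootDecompWalshStrata.ConicDescent.BallCube
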